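/-
Copyright (c) 2026. All rights reserved.
Released under Apache 2.0 license as described in the file LICENSE.
Authors: abc-iut cell, prover seat abc-iut-L4-d2 (gen 9).
-/
import Literature.AnabelianGeometry.AbsoluteAnabelian.GaloisTheatersNumberFieldShadowTFPairsArchModel
import Literature.AnabelianGeometry.AbsoluteAnabelian.GaloisTheatersNumberFieldShadowTFPairsModelCor52
import Literature.AnabelianGeometry.AbsoluteAnabelian.GaloisTheatersNumberFieldShadowPanalocalTPairsExists
import Literature.AnabelianGeometry.AbsoluteAnabelian.GaloisTheatersNumberFieldShadowPanalocalTPairsMapsHom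
import HarnessLib

/-!
# [AbsTopIII] Cor 5.2 (iii), (iv), (vi) object/morphism parts and (vii)-faithfulness PROVED at the `TF`-shadow vocabulary with
# BOTH local-pair predicates in print shape

S. Mochizuki, *Topics in absolute anabelian geometry III* [MochizukiAbsTopIII2015], Cor 5.2 (iii)/(iv) pp. 119–120, Cor 5.2 (vi)
p. 120, Cor 5.2 (vii) p. 121, Def 3.1 (ii) p. 67, Def 4.1 (ii) p. 102.

PROOF-ONLY companion of `GaloisTheatersNumberFieldShadowTFPairsArchModel.lean` (abc-iut-L4-d2 g9: `fieldShadowVocabulary'' F` =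
the `TF`-shadow vocabulary with `IsMLFGaloisPair := IsShadowMLFGaloisTFPair` AND `IsAutHolPair := IsShadowAutHolTFPair`, both
"isomorphic to a model pair").  Every row proved at the primed vocabulary transfers:

* `referencePairIsoUnique_fieldShadow''` (**F-0189**), `tPairHomDeterminedByTheaterHom_fieldShadow''` (**F-0191**) — forget to the
  unprimed vocabulary (the model predicates refine the group-theoretic / injectivity ones); `tPairIsoCanonical_fieldShadow''`
  (**F-0192**) — descent, the archimedean descent law being `IsShadowAutHolTFPair.of_kummerTransportTF`;
  `tPairEAHomExtends_fieldShadow''` (**F-0190**) — transfer of the unprimed extension;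
* `panalocalTPairHomDetermined_fieldShadow''` (**F-3089**) — Prop 3.2 (iv) at the source pair, injectivity of the Kummer embedding;
* `panalocalTPairExists_fieldShadowWith₂` (the F-3085 construction reads NEITHER local-pair predicate; re-run of
  `panalocalTPairExists_fieldShadowWith` with the archimedean predicate free) ⇒ `panalocalTPairExists_fieldShadow''` (**F-3085**);
  `panalocalTPairMapsHom_fieldShadow''` (**F-3086**, from `panalocalTPairMapsHom_fieldShadowWith`).

NOT here: Cor 5.2 (vi) essential surjectivity `PanalocalTPairEssSurj` (F-3087) at this vocabulary — its archimedean clause is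
provable, its nonarchimedean clause is equivalent to a conjugacy statement for open subgroups of decomposition groups of `G_ℚ`
(successor file).  HONEST LABEL: shadow (`Δ = 1`) ≠ the genuine `(R, W)` (E-L4-13).  No `def`/`instance`/`structure`; nothing here
bears on [IUTchIII] Cor. 3.12 or takes a side; typed ≠ proved.
-/

noncomputable section

open scoped Pointwise Topology
open CategoryTheory NumberField Field

namespace Literature.AnabelianGeometry.AbsoluteAnabelian

namespace NumberFieldShadow

variable (F : Type) [Field F] [NumberField F]

/-! ### Cor 5.2 (iii) at the doubly primed vocabulary (forget to the unprimed one) -/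

/-- **F-0189 at `fieldShadowVocabulary'' F`**: the reference isomorphisms of a global `TF`-pair are unique.
[cite: MochizukiAbsTopIII2015, Cor 5.2 (iii) p.119] -/
theorem referencePairIsoUnique_fieldShadow'' : ReferencePairIsoUnique (fieldShadowVocabulary'' F) tf_ne_tlg := by
  intro P ψV hψV hnon harc ψ ψ' ψnon ψnon' ψarc ψarc' href href'
  exact referencePairIsoUnique_fieldShadow F
    { theater := P.theater, M := P.M, act := P.act, isCont := P.isCont, Mnon := P.Mnon, Marc := P.Marc,
      actNon := P.actNon, isMLF := fun v => IsShadowMLFGaloisTFPair.isMLFGaloisType (P.isMLF v),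
      kummer := P.kummer, isAutHol := fun v => IsShadowAutHolTFPair.injective (P.isAutHol v), ρnon := P.ρnon, ρarc := P.ρarc,
      exists_reference := P.exists_reference }
    ψV hψV hnon harc ψ ψ' ψnon ψnon' ψarc ψarc' href href'

/-- **F-0191 at `fieldShadowVocabulary'' F`**: `φ⊚`, `{φ_v}` of a morphism of global `TF`-pairs are determined by `φ_{V⊚}`.
[cite: MochizukiAbsTopIII2015, Cor 5.2 (iii) p.119] -/
theorem tPairHomDeterminedByTheaterHom_fieldShadow'' :
    TPairHomDeterminedByTheaterHom (fieldShadowVocabulary'' F) tf_ne_tlg := by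
  intro P₁ P₂ φ φ' hV
  let Q₁ : GlobalTPair (fieldShadowVocabulary F) :=
    { theater := P₁.theater, M := P₁.M, act := P₁.act, isCont := P₁.isCont, Mnon := P₁.Mnon, Marc := P₁.Marc,
      actNon := P₁.actNon, isMLF := fun v => IsShadowMLFGaloisTFPair.isMLFGaloisType (P₁.isMLF v),
      kummer := P₁.kummer, isAutHol := fun v => IsShadowAutHolTFPair.injective (P₁.isAutHol v),
      ρnon := P₁.ρnon, ρarc := P₁.ρarc, exists_reference := P₁.exists_reference }
  let Q₂ : GlobalTPair (fieldShadowVocabulary F) :=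
    { theater := P₂.theater, M := P₂.M, act := P₂.act, isCont := P₂.isCont, Mnon := P₂.Mnon, Marc := P₂.Marc,
      actNon := P₂.actNon, isMLF := fun v => IsShadowMLFGaloisTFPair.isMLFGaloisType (P₂.isMLF v),
      kummer := P₂.kummer, isAutHol := fun v => IsShadowAutHolTFPair.injective (P₂.isAutHol v),
      ρnon := P₂.ρnon, ρarc := P₂.ρarc, exists_reference := P₂.exists_reference }
  let ξ : GlobalTPair.Hom (fieldShadowVocabulary F) Q₁ Q₂ :=
    { φV := φ.φV, φM := φ.φM, φM_equivariant := φ.φM_equivariant, non_mem := φ.non_mem, arc_mem := φ.arc_mem,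
      φnon := φ.φnon, φnon_equivariant := φ.φnon_equivariant, φarc := φ.φarc, φarc_kummer := φ.φarc_kummer,
      ρnon_comm := φ.ρnon_comm, ρarc_comm := φ.ρarc_comm }
  let ξ' : GlobalTPair.Hom (fieldShadowVocabulary F) Q₁ Q₂ :=
    { φV := φ'.φV, φM := φ'.φM, φM_equivariant := φ'.φM_equivariant, non_mem := φ'.non_mem, arc_mem := φ'.arc_mem,
      φnon := φ'.φnon, φnon_equivariant := φ'.φnon_equivariant, φarc := φ'.φarc, φarc_kummer := φ'.φarc_kummer,
      ρnon_comm := φ'.ρnon_comm, ρarc_comm := φ'.ρarc_comm }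
  exact tPairHomDeterminedByTheaterHom_fieldShadow F Q₁ Q₂ ξ ξ' hV

/-! ### Cor 5.2 (iv) at the doubly primed vocabulary -/

/-- **F-0192 at `fieldShadowVocabulary'' F`**: every global `TF`-pair is isomorphic over `𝟙_Π` to the canonical one (descent; the
archimedean descent law is `IsShadowAutHolTFPair.of_kummerTransportTF`). [cite: MochizukiAbsTopIII2015, Cor 5.2 (iv) p.120] -/
theorem tPairIsoCanonical_fieldShadow'' : TPairIsoCanonical (fieldShadowVocabulary'' F) tf_ne_tlg :=
  (fieldShadowVocabulary'' F).tPairIsoCanonical_of_descent tf_ne_tlg (context_mapKNF_id F)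
    (fun a b ψ h hb => isContGlob_descends_fieldShadow F a b ψ h hb)
    (fun _ _ e ψ h hb => IsShadowMLFGaloisTFPair.of_iso hb e ψ h)
    (fun i ψ _ hk => IsShadowAutHolTFPair.of_kummerTransportTF i ψ hk)

/-- **F-0190 at `fieldShadowVocabulary'' F`**: morphisms of `EA⊚` between admissibles extend to the canonical global `TF`-pairs.
[cite: MochizukiAbsTopIII2015, Cor 5.2 (iv) p.120] -/
theorem tPairEAHomExtends_fieldShadow'' : TPairEAHomExtends (fieldShadowVocabulary'' F) tf_ne_tlg := by
  intro E₁ E₂ h₁ h₂ hc₁ hM₁ hA₁ hc₂ hM₂ hA₂ f hf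
  obtain ⟨φ, hφ⟩ := tPairEAHomExtends_fieldShadow F E₁ E₂ h₁ h₂ hc₁
    (fun v => IsShadowMLFGaloisTFPair.isMLFGaloisType (hM₁ v)) (fun v => IsShadowAutHolTFPair.injective (hA₁ v)) hc₂
    (fun v => IsShadowMLFGaloisTFPair.isMLFGaloisType (hM₂ v)) (fun v => IsShadowAutHolTFPair.injective (hA₂ v)) f hf
  exact ⟨{ φV := φ.φV, φM := φ.φM, φM_equivariant := φ.φM_equivariant, non_mem := φ.non_mem, arc_mem := φ.arc_mem,
           φnon := φ.φnon, φnon_equivariant := φ.φnon_equivariant, φarc := φ.φarc, φarc_kummer := φ.φarc_kummer,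
           ρnon_comm := φ.ρnon_comm, ρarc_comm := φ.ρarc_comm }, hφ⟩

/-! ### Cor 5.2 (vii), faithfulness, at the doubly primed vocabulary -/

/-- **F-3089 at `fieldShadowVocabulary'' F`**: a morphism of panalocal `TF`-pairs is determined by its morphism of panalocal
Galois-theaters (nonarchimedean: Prop 3.2 (iv) at the source pair; archimedean: injectivity of the Kummer embedding of a model
pair and of `A_{X₁} ≅ A_{X₂}`). [cite: MochizukiAbsTopIII2015, Cor 5.2 (vii) p.121] -/
theorem panalocalTPairHomDetermined_fieldShadow'' :
    PanalocalTPairHomDetermined (fieldShadowVocabulary'' F) tf_ne_tlg := by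
  intro Q₁ Q₂ φ φ' hV
  obtain ⟨φV, φn, hne, φa, hak⟩ := φ
  obtain ⟨φV', φn', hne', φa', hak'⟩ := φ'
  cases hV
  have h1 : φn = φn' := by
    funext v
    refine iso_eq_of_conj_trans_symm_eq_refl (Iso.refl _) (φn v) (φn' v) ?_
    rw [Iso.refl_trans, Iso.refl_symm, Iso.trans_refl]
    refine IsShadowMLFGaloisTFPair.eq_refl_of_equivariant (Q₁.data.isMLF v) _ fun g => ?_
    refine CommRingCat.hom_ext (RingHom.ext fun x => ?_)
    change (φn' v).inv.hom ((φn v).hom.hom (((Q₁.data.actNon v) g).hom.hom x)) =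
      ((Q₁.data.actNon v) g).hom.hom ((φn' v).inv.hom ((φn v).hom.hom x))
    rw [iso_hom_conj (φn v) _ _ (hne v g), iso_inv_conj (φn' v) _ _ (hne' v g)]
  have h2 : φa = φa' := by
    funext v
    have hk₀ : kummerTransportTF (φV.archIso v) (φa v)
        (show (show CommRingCat.{0} from Q₁.data.Marc v) →+* (Q₁.theater.X v).fieldA from Q₁.data.kummer v) =
        (show (show CommRingCat.{0} from Q₂.data.Marc ⟨φV.φV v, φV.arc_mem v⟩) →+*
          (Q₂.theater.X ⟨φV.φV v, φV.arc_mem v⟩).fieldA from Q₂.data.kummer ⟨φV.φV v, φV.arc_mem v⟩) := hak v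
    have hk₀' : kummerTransportTF (φV.archIso v) (φa' v)
        (show (show CommRingCat.{0} from Q₁.data.Marc v) →+* (Q₁.theater.X v).fieldA from Q₁.data.kummer v) =
        (show (show CommRingCat.{0} from Q₂.data.Marc ⟨φV.φV v, φV.arc_mem v⟩) →+*
          (Q₂.theater.X ⟨φV.φV v, φV.arc_mem v⟩).fieldA from Q₂.data.kummer ⟨φV.φV v, φV.arc_mem v⟩) := hak' v
    have hinjk : Function.Injective
        (show (show CommRingCat.{0} from Q₁.data.Marc v) →+* (Q₁.theater.X v).fieldA from Q₁.data.kummer v) :=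
      IsShadowAutHolTFPair.injective (Q₁.data.isAutHol v)
    refine iso_eq_of_forall_inv_apply fun s => hinjk ((φV.archIso v).fieldIso.injective ?_)
    have e1 := congrArg (fun k => k s) hk₀
    have e2 := congrArg (fun k => k s) hk₀'
    exact e1.trans e2.symm
  subst h1 h2
  rfl

/-! ### Cor 5.2 (vi), object and morphism parts, at the doubly primed vocabulary -/

/-- **F-3085 at every `TF`-shadow vocabulary with BOTH local-pair predicates free** (re-run of
`panalocalTPairExists_fieldShadowWith`: the panalocalization of a global `TF`-pair reads neither predicate).
[cite: MochizukiAbsTopIII2015, Cor 5.2 (vi) p.120] -/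
theorem panalocalTPairExists_fieldShadowWith₂
    (P : ∀ {D : ProfiniteGrp.{0}} {M : CommRingCat.{0}}, (D →* Aut M) → Prop)
    (P' : ∀ {X : AutHolOrbispace.{0}} {M : CommRingCat.{0}}, ((M : Type) →+* X.fieldA) → Prop) :
    PanalocalTPairExists ({ fieldShadowVocabulary F with
        IsMLFGaloisPair := fun {_} {_} act => P act, IsAutHolPair := fun {_} {_} κ => P' κ } :
      TPairVocabulary (context F) .TF) := by
  intro M
  letI := (NumberField.valuationProSet ℚ).action
  obtain ⟨ψV, hψV, hnon, harc, ψ, ψnon, ψarc, -, hb, hc, -, -⟩ := M.exists_reference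
  have hadm : IsAdmissible F M.theater.ext := M.theater.isAdmissible
  -- decomposition groups and local elements along the reference isomorphism `ψ_V`
  have hdec : ∀ u : ((context F).proVal M.theater.ext).carrier,
      ((context F).proVal M.theater.ext).decomp u = M.theater.V.decomp (ψV u) := fun u => by
    ext g
    simp only [GaloisProSet.decomp, MulAction.mem_stabilizer_iff]
    rw [← hψV.1, ψV.injective.eq_iff]
  /- (1) THE PANALOCAL GALOIS-THEATER `V⊚(Π_E)/Aut(Π_E)` with the groups / orbispaces of `M⊚` at chosen lifts -/
  have hgenE : ∀ (α : M.theater.ext ≅ M.theater.ext) (hα : IsEAHom α.hom),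
      (context F).mapProVal α.hom hα ((context F).proVal M.theater.ext).generic =
        ((context F).proVal M.theater.ext).generic := fun α hα => contextMapProVal_generic α.hom hα
  have hnonE : ∀ (α : M.theater.ext ≅ M.theater.ext) (hα : IsEAHom α.hom)
      (v : ((context F).proVal M.theater.ext).carrier), v ∈ ((context F).proVal M.theater.ext).non →
        (context F).mapProVal α.hom hα v ∈ ((context F).proVal M.theater.ext).non :=
    fun α hα v hv => contextMapProVal_mem_non α.hom hα v hv
  have harcE : ∀ (α : M.theater.ext ≅ M.theater.ext) (hα : IsEAHom α.hom)
      (v : ((context F).proVal M.theater.ext).carrier), v ∈ ((context F).proVal M.theater.ext).arc →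
        (context F).mapProVal α.hom hα v ∈ ((context F).proVal M.theater.ext).arc :=
    fun α hα v hv => contextMapProVal_mem_arc α.hom hα v hv
  have hn : ∀ q : ↥((context F).toModAut M.theater.ext '' ((context F).proVal M.theater.ext).non),
      ∃ vl, vl ∈ ((context F).proVal M.theater.ext).non ∧ (context F).toModAut M.theater.ext vl = q.1 :=
    fun q => q.2
  have har : ∀ q : ↥((context F).toModAut M.theater.ext '' ((context F).proVal M.theater.ext).arc),
      ∃ vl : ((context F).proVal M.theater.ext).arc, (context F).toModAut M.theater.ext vl.1 = q.1 := fun q => by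
    obtain ⟨vl, hvl, hq⟩ := q.2
    exact ⟨⟨vl, hvl⟩, hq⟩
  choose ln hln_mem hln_eq using hn
  choose la hla_eq using har
  have hlnV : ∀ q, ψV (ln q) ∈ M.theater.V.non := fun q => hnon ⟨ln q, hln_mem q⟩
  have hlaV : ∀ q, ψV (la q).1 ∈ M.theater.V.arc := fun q => harc (la q)
  have href : IsPanalocalReferenceFor (context F) ((context F).toModAut M.theater.ext
      ((context F).proVal M.theater.ext).generic)
      ((context F).toModAut M.theater.ext '' ((context F).proVal M.theater.ext).non)
      ((context F).toModAut M.theater.ext '' ((context F).proVal M.theater.ext).arc)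
      (fun q => M.theater.V.decompGrp (ψV (ln q))) (fun q => M.theater.X ⟨ψV (la q).1, hlaV q⟩)
      M.theater.ext (Equiv.refl _) := by
    refine ⟨rfl, fun v hv => Set.mem_image_of_mem _ hv, fun v hv => Set.mem_image_of_mem _ hv,
      fun q => ⟨ln q, hln_mem q, hln_eq q, ?_⟩, fun q => ⟨la q, hla_eq q, ?_⟩⟩
    · exact nonempty_continuousMulEquiv_ofClosedSubgroup_of_eq _ _ (hdec (ln q)).symm
    · obtain ⟨j, -⟩ := hψV.2.2.2.2 (la q) (hlaV q)
      exact ⟨⟨j.toHomeomorph.symm, j.fieldIso.symm, j.pi1Iso.symm⟩⟩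
  let T : PanalocalGaloisTheater (context F) :=
    { V := (context F).ProValModAut M.theater.ext
      generic := (context F).toModAut M.theater.ext ((context F).proVal M.theater.ext).generic
      non := (context F).toModAut M.theater.ext '' ((context F).proVal M.theater.ext).non
      arc := (context F).toModAut M.theater.ext '' ((context F).proVal M.theater.ext).arc
      generic_notMem_non := GlobalAnabelianContext.toModAut_generic_notMem_image_non hgenE hnonE harcE
      generic_notMem_arc := GlobalAnabelianContext.toModAut_generic_notMem_image_arc hgenE hnonE harcE
      disjoint_non_arc := GlobalAnabelianContext.disjoint_image_non_image_arc hgenE hnonE harcE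
      eq_generic_or_mem := (context F).eq_toModAut_generic_or_mem_image
      grp := fun q => M.theater.V.decompGrp (ψV (ln q))
      X := fun q => M.theater.X ⟨ψV (la q).1, hlaV q⟩
      exists_reference := ⟨M.theater.ext, hadm, Equiv.refl _, href⟩ }
  /- (2) THE PANALOCAL `TF`-PAIR `{M⊚}✠`; the identifications at arbitrary lifts by the transport lemmas -/
  have clauseNon : ∀ (vl : ((context F).proVal M.theater.ext).carrier) (hvl : ψV vl ∈ M.theater.V.non)
      (hq : (Equiv.refl _) ((context F).toModAut M.theater.ext vl) ∈
        (context F).toModAut M.theater.ext '' ((context F).proVal M.theater.ext).non),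
      ∃ (e : M.theater.V.decompGrp (ψV vl) ≃ₜ* M.theater.V.decompGrp (ψV (ln ⟨_, hq⟩)))
        (φ : M.Mnon ⟨ψV vl, hvl⟩ ≅ M.Mnon ⟨ψV (ln ⟨_, hq⟩), hlnV ⟨_, hq⟩⟩),
        ∀ g, (M.actNon ⟨ψV vl, hvl⟩ g).hom ≫ φ.hom =
          φ.hom ≫ (M.actNon ⟨ψV (ln ⟨_, hq⟩), hlnV ⟨_, hq⟩⟩ (e g)).hom := by
    intro vl hvl hq
    have heq : (context F).toModAut M.theater.ext vl = (context F).toModAut M.theater.ext (ln ⟨_, hq⟩) :=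
      (hln_eq ⟨_, hq⟩).symm
    obtain ⟨α, hα, hαv⟩ := exists_iso_mapProVal_eq_of_toModAut_eq F heq
    exact exists_decompGrpIso_actIso_of_mapProVal_eq F M.theater ψV hψV hnon M.Mnon M.actNon ψnon hb α hα vl
      (ln ⟨_, hq⟩) hαv hvl (hlnV ⟨_, hq⟩)
  have clauseArc : ∀ (vl : ((context F).proVal M.theater.ext).carrier) (hvl : ψV vl ∈ M.theater.V.arc)
      (hq : (Equiv.refl _) ((context F).toModAut M.theater.ext vl) ∈
        (context F).toModAut M.theater.ext '' ((context F).proVal M.theater.ext).arc),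
      ∃ (x : AutHolOrbispace.Iso (M.theater.X ⟨ψV vl, hvl⟩) (M.theater.X ⟨ψV (la ⟨_, hq⟩).1, hlaV ⟨_, hq⟩⟩))
        (φ : M.Marc ⟨ψV vl, hvl⟩ ≅ M.Marc ⟨ψV (la ⟨_, hq⟩).1, hlaV ⟨_, hq⟩⟩),
        ({ fieldShadowVocabulary F with
            IsMLFGaloisPair := fun {_} {_} act => P act, IsAutHolPair := fun {_} {_} κ => P' κ } :
          TPairVocabulary (context F) .TF).kummerTransport x φ (M.kummer ⟨ψV vl, hvl⟩) =
          M.kummer ⟨ψV (la ⟨_, hq⟩).1, hlaV ⟨_, hq⟩⟩ := by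
    intro vl hvl hq
    have heq : (context F).toModAut M.theater.ext vl = (context F).toModAut M.theater.ext (la ⟨_, hq⟩).1 :=
      (hla_eq ⟨_, hq⟩).symm
    obtain ⟨α, hα, hαv⟩ := exists_iso_mapProVal_eq_of_toModAut_eq F heq
    exact exists_archIso_kummerIso_of_mapProVal_eq F M.theater ψV hψV harc M.Marc M.kummer ψarc
      (fun u => by obtain ⟨j, -, -, hj⟩ := hc u; exact ⟨j, hj⟩) α hα vl (la ⟨_, hq⟩).1 hαv hvl (hlaV ⟨_, hq⟩)
  exact ⟨{ theater := T
           data :=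
             { Mnon := fun q => M.Mnon ⟨ψV (ln q), hlnV q⟩
               actNon := fun q => M.actNon ⟨ψV (ln q), hlnV q⟩
               isMLF := fun q => M.isMLF ⟨ψV (ln q), hlnV q⟩
               Marc := fun q => M.Marc ⟨ψV (la q).1, hlaV q⟩
               kummer := fun q => M.kummer ⟨ψV (la q).1, hlaV q⟩
               isAutHol := fun q => M.isAutHol ⟨ψV (la q).1, hlaV q⟩ } },
    ψV, hψV, Equiv.refl _, href, clauseNon, clauseArc⟩


/-- **F-3085 at `fieldShadowVocabulary'' F`.** [cite: MochizukiAbsTopIII2015, Cor 5.2 (vi) p.120] -/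
theorem panalocalTPairExists_fieldShadow'' : PanalocalTPairExists (fieldShadowVocabulary'' F) :=
  panalocalTPairExists_fieldShadowWith₂ F (fun {_} {_} act => IsShadowMLFGaloisTFPair act)
    (fun {_} {_} κ => IsShadowAutHolTFPair κ)

/-- **F-3086 at `fieldShadowVocabulary'' F`.** [cite: MochizukiAbsTopIII2015, Cor 5.2 (vi) p.120] -/
theorem panalocalTPairMapsHom_fieldShadow'' : PanalocalTPairMapsHom (fieldShadowVocabulary'' F) :=
  panalocalTPairMapsHom_fieldShadowWith F (fun {_} {_} act => IsShadowMLFGaloisTFPair act)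
    (fun {_} {_} κ => IsShadowAutHolTFPair κ)

end NumberFieldShadow

end Literature.AnabelianGeometry.AbsoluteAnabelian

end
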